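import Mathlib
import HarnessLib
import HarnessLib.Audit
import Summits.AtomisticToContinuum.Statement

/-!
Route: AdiabaticPistons

CLOSED (retired) 2026-08-15T13:38:26Z by operator:999:1257524 — reason: not-a-thesis: assembly does not conclude the sub-problem Statement — note: D-0027 §2.1 audit (human 2026-08-15: routes that do not decide the summit are removed): the assembly concludes `Literature.MathematicalPhysics.KineticTheory.HydrodynamicLimit`, not the sub-problem statement; a NEW conforming route may be opened from the same idea (generated `closes : … → _root_.Hydr. The file is kept as the record of this route; refuted decls are indexed as negative knowledge (`ledger negatives`).

# Route AdiabaticPistons — Euler is kinematics — Lagrangian cells are adiabatic pistons, so the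
momentum field alone suffices (card anosov-kasuga-pistons)

X = MOMENTUM LIMIT: it suffices to show that, for small reduced density σ, the empirical MOMENTUM
field of the deterministic hard-sphere
gas with local Gibbs data converges in probability to ρu of the classical hs-Euler solution at every
pre-shock time (typed target
MomentumLimit; it also records that the local Gibbs laws are probability measures). The other four
fields are slaved to it: the density
field follows EXACTLY, because the microscopic continuity equation is an identity along hard-sphere
trajectories (support
DensityFromMomentum, provable now), and the energy field follows by ADIABATIC CLOSURE (crux
AdiabaticClosure: given the kinematic fields,
the internal energy of every Lagrangian parcel obeys dE = −p dV with the hard-sphere pressure law —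
"Lagrangian cells are adiabatic
pistons", the corrected core of card anosov-kasuga-pistons, which absorbed
ergodic-adiabatic-otto-reduction and bernoulli-piston-chain).
The structural premise of the whole line is RELATIVE LAGRANGIAN COHERENCE (crux RelativeCoherence:
at fixed reduced density neighbouring
spheres have equal macroscopic displacements up to strain·r² + o(1), i.e. self-diffusion is
sub-macroscopic, N^(−1/6)), which makes
Lagrangian parcels asymptotically CLOSED systems. The card's device for X itself — the PISTON GAS
(massless specular walls on an
Euler-transported grid impose the kinematics; each closed cell follows the hs adiabat) plus WALL
TRANSPARENCY (removing the walls changes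
no macroscopic field) — is filed as two informal cruxes (WallTransparency rank 2, PistonCellAdiabat
rank 5) pending the definition of a
hard-sphere flow with moving specular walls.
Lean: `∀ (a₀ θ₀ : Literature.MathematicalPhysics.KineticTheory.T3 → ℝ) (u₀ :
Literature.MathematicalPhysics.KineticTheory.T3 → Literature.MathematicalPhysics.KineticTheory.V3),
Continuous a₀ → Continuous θ₀ → Continuous u₀ → (∀ x, 0 < a₀ x) → (∀ x, 0 < θ₀ x) → ∃ σ₀ : ℝ, 0 < σ₀
∧ ∀ σ : ℝ, 0 < σ → σ < σ₀ → ∀ (T : ℝ) (ρ θ : ℝ → Literature.MathematicalPhysics.KineticTheory.T3 →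
ℝ) (u : ℝ → Literature.MathematicalPhysics.KineticTheory.T3 →
Literature.MathematicalPhysics.KineticTheory.V3),
Literature.MathematicalPhysics.KineticTheory.IsHardSphereEulerSolution σ T ρ u θ → ∀ Φ : (N : ℕ) →
Literature.Analysis.FluidPDE.HardSphereFlow (Literature.Analysis.FluidPDE.Torus.geometry (Fin 3))
(Literature.MathematicalPhysics.KineticTheory.hsDiameter σ N) (N + 1), (∀ N,
MeasureTheory.IsProbabilityMeasure (Literature.MathematicalPhysics.KineticTheory.localGibbsLaw σ a₀
u₀ θ₀ N (Φ N))) ∧ (Literature.MathematicalPhysics.KineticTheory.TendstoHydroFieldsAt (fun N =>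
Literature.MathematicalPhysics.KineticTheory.localGibbsLaw σ a₀ u₀ θ₀ N (Φ N)) Φ ρ u θ 0 → ∀ t ∈
Set.Ico 0 T, ∀ χ : Literature.MathematicalPhysics.KineticTheory.T3 → ℝ, Continuous χ → ∀ δ : ℝ, 0 <
δ → Filter.Tendsto (fun N => Literature.MathematicalPhysics.KineticTheory.localGibbsLaw σ a₀ u₀ θ₀ N
(Φ N) {z | δ < ‖Literature.MathematicalPhysics.KineticTheory.empiricalMomentumField ((Φ N).flow t z)
χ - ∫ x, (χ x * ρ t x) • u t x‖}) Filter.atTop (nhds 0))`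

## Assembly
Pure logic (proved sorry-free as `assembly_holds` in the planner's Sketch.lean): fix profiles; take
σ₀ = min of the σ₀'s of MomentumLimit and
AdiabaticClosure; for σ < σ₀, a solution, flows and converging initial fields, MomentumLimit gives
the probability-measure clause and the
momentum field at all t < T, DensityFromMomentum the density field, AdiabaticClosure the energy
field; repackage the three into
TendstoHydroFieldsAt at each t.

Rationale: WHY THIS LINE. Every open route proves local equilibrium for all five fields at once (entropy:
RelEntropyErgodic, ChaoticMixing, VanishingNoise,
KineticWindows; cumulants: DenseKineticExpansion; Young measures: DissipativeWeakStrong). This line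
splits the conjunct along the
physics of the piston: KINEMATICS (where parcels go — the momentum field; density is then an exact
consequence of Spohn1991 (3.3)–(3.6),
PDF p41–42) versus THERMODYNAMICS (what happens inside a closed parcel — the adiabat, Kasuga1961 /
LochakMeunier1988 ergodic adiabatic
theorem in spirit, NeishtadtSinai2004 and Wright2007 Thm 1 for one piston with an ideal gas). The
scale audit in this route corrects the
card: Kasuga's GLOBAL cell ergodisation is available only for cells ≪ N^(−1/6) while closedness
needs cells ≫ N^(−1/6) (Lewis number of
the dilute hard-sphere gas ≈ 1.26, ChapmanCowling1970 PDF p244, p246), so the adiabatic law must and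
can be run with LOCAL kinetic
relaxation + quasi-static mechanics on cells of fixed macroscopic size (the ideal part p = 2e/3 of
the pressure–energy relation is an
identity, no local equilibrium needed). Imported area: averaging / adiabatic-invariant theory of
slow–fast Hamiltonian systems
(Anosov, Kasuga, Neishtadt–Sinai, Wright) and the kinetic theory of self-diffusion (Spohn1991 §8.9
PDF p149–151,
BodineauGallagherSaintRaymondInvent2016 at Boltzmann–Grad); no entropy functional, no large
deviations, no noise. Negatives index empty.

RANKED CRUXES. #0 MomentumLimit (target) — for all continuous local-equilibrium profiles ∃ σ₀ ∀ σ<σ₀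
∀ classical hs-Euler solutions on [0,T) ∀ hard-sphere flows: the local Gibbs laws are probability
measures and, if the three fields converge at t = 0, then at every t < T the empirical MOMENTUM
field tested against every continuous χ converges in probability to ∫χρ_t u_t. (why it might fail:
it is the kinematic two-thirds of the conjunct: needs the momentum-flux closure Π → ρu⊗u + p𝟙 along
the deterministic flow at fixed density; no dynamical mixing theorem exists (Spohn1991 PDF p11); the
piston device moves the burden to WallTransparency.) [Spohn1991, OllaVaradhanYau1993, Wright2007,
NeishtadtSinai2004]
#3 RelativeCoherence (crux) — RELATIVE LAGRANGIAN COHERENCE (closed parcels; card § Mechanism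
"self-diffusion is sub-macroscopic"): for profiles, σ < σ₀, a classical hs-Euler solution on [0,T),
flows with probability local Gibbs laws whose fields converge at 0, there is C such that for every t
< T, r > 0, η > 0 the probability that the pair-weighted mean square difference of LIFTED
displacements ∫₀ᵗ v_i − ∫₀ᵗ v_j over pairs initially within torus distance r (tent weight, diagonal
included) exceeds C r² + η tends to 0 as N → ∞. False for the ideal gas and at Boltzmann–Grad
(ballistic flights); the statement uses collisions. [difficulty: XL] (why it might fail: needs decay
of a tagged sphere's peculiar-velocity autocorrelation over kinetic times in a NON-equilibrium gas
at fixed density (displacement ≍ N^(−1/6)); rigorous self-diffusion exists only in equilibrium at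
Boltzmann–Grad (BGSR 2016); a persistent ballistic sub-population would break it.) [Spohn1991,
BodineauGallagherSaintRaymondInvent2016, AlderWainwright1970, ChapmanCowling1970]
#4 AdiabaticClosure (crux) — ADIABATIC CLOSURE (Lagrangian cells are adiabatic pistons; card cruxes
1–2 corrected): for profiles ∃ σ₀ ∀ σ<σ₀ ∀ classical hs-Euler solutions on [0,T) ∀ flows with
probability local Gibbs laws and fields converging at 0: IF the density and momentum fields converge
at every s ∈ [0,T) THEN the energy field converges at every t ∈ [0,T) to ∫χE_t, E = ρ(|u|²/2 + 3θ/2)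
— the temperature follows the hard-sphere adiabat transported by the flow. Mechanism: closed parcels
(RelativeCoherence) + local velocity isotropy ⇒ time-averaged stress π𝟙 with π_kin = 2e_int/3
identically; kinematics fix ∇π = ∇p; global energy conservation fixes the constant; contact
statistics give the excess part ρθ(Z−1). [deps: RelativeCoherence] [difficulty: XL] (why it might
fail: kinematic fields do not control the deviatoric stress or the heat current: a divergence-free
anomalous stress S with S:∇u ≠ 0, or an O(1) heat flux, would move internal energy between parcels
at Euler order while ρ, ρu stay exact; needs local isotropy + contact statistics.) [Spohn1991,
Kasuga1961, LochakMeunier1988, Wright2007, ChapmanCowling1970]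
#9 DensityFromMomentum (support) — THE CONTINUITY EQUATION IS FREE: for every σ > 0, hs-Euler
solution on [0,T), flows, probability local Gibbs laws with fields converging at 0: if the momentum
field converges at every s ∈ [0,T) then the density field converges at every t ∈ [0,T). Proof:
positions are continuous and piecewise free flights (IsHardSphereTrajectory.eq_freeFlight), so
⟨ρ_N(t),χ⟩ − ⟨ρ_N(0),χ⟩ = ∫₀ᵗ Σ_k (empiricalMomentumField (∂_kχ))_k ds exactly for C¹ χ; momentum
convergence at each s + tightness of kinetic energy per particle (energy field at 0, conservation) +
dominated convergence ⇒ limit ∫₀ᵗ∫ρu·∇χ = ∫χρ_t − ∫χρ_0 by the Euler mass equation; approximate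
continuous χ uniformly. Chore: joint measurability of (s,z) ↦ flow s z on the good set (piecewise
continuity). [difficulty: M] [Spohn1991]

TWO-LAYER PLAN. MomentumLimit ⇐ PistonKinematics → WallTransparency → MomentumLimit (k = 2):
PistonKinematics = for the piston gas (N spheres + massless
specular walls on the faces of a δ-grid transported by the Euler flow map, δ fixed then δ → 0) the
momentum field converges — nearly
tautological once PistonCellAdiabat keeps cells in local equilibrium, since the walls impose u;
WallTransparency = free-gas minus piston-gas
fields → 0 in probability (N → ∞ then δ → 0). AdiabaticClosure ⇐ LocalIsotropy → ContactPressure →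
AdiabaticClosure (k = 2): window-averaged
traceless kinetic stress and kinetic heat flux about the Euler velocity vanish in probability
(1-body, kinetic times; cf. the RKM statement
of card closed-cells-mix-hydrodynamically-slowly and KineticWindows' KineticWindowLD in LD
currency), and the collisional momentum transfer
has the local-equilibrium contact value (2-body; shares VirialEosIdentification 0782).
RelativeCoherence ⇐ PeculiarVelocityDecorrelation →
RelativeCoherence (k = 1 + bookkeeping). Nothing here is filed now; WallTransparency and
PistonCellAdiabat are filed as informal layer-1
cruxes right after open because they are the card's mechanism and need the definition
MovingWallHardSphereFlow.

KILL CRITERIA. ¬RelativeCoherence at some fixed σ > 0 (macroscopic self-diffusion at Euler scale,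
e.g. a positive fraction of spheres with ballistic
peculiar flights over times O(1)) closes the route outright (`close --reason
refuted:RelativeCoherence`): without closed parcels there are no
pistons. ¬AdiabaticClosure (correct kinematics, wrong energy field for some smooth pre-shock data)
closes the route and is strong evidence
for ¬HydrodynamicLimit — file ¬HydrodynamicLimitFor then. ¬WallTransparency for cells of fixed
macroscopic size (walls at spacing δ ≫ N^(−1/6)
change a macroscopic field at leading order) forces a pivot to the wall-free variant
(lagrangian-coherence-retardation's fading-memory
closure) — restate, do not close. MomentumLimit proved elsewhere (any route proving the conjunct)
moots the target but leaves AdiabaticClosure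
and DensityFromMomentum as the cheapest certified decomposition.

NOT DECOMPOSED YET. The piston gas itself (needs MovingWallHardSphereFlow: hard-sphere flow in a
time-dependent cell with specular reflection v ↦ v − 2((v−w)·n)n
off walls moving with velocity w; Liouville on the moving domain; a.e. existence as a hypothesis
structure like Kinetic.HardSphereFlow);
the fixed-n rung (n balls per cell, N → ∞: a many-cell Kasuga theorem with the finite-n adiabat, n =
2 unconditional by Simanyi1999 box
ergodicity in slab symmetry — bernoulli-piston-chain's rung 0, Wright2007 technology); the uniform
local-relaxation input (left to
ChaoticMixing's repair / KineticWindows); constants C(T, ∇u) in RelativeCoherence; the C¹ → C⁰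
approximation and joint-measurability chores
in DensityFromMomentum; the choice δ_N for transparency (heuristic error Kn_cell = N^(−1/3)/δ).

CHEAPEST FALSIFIER. Event-driven MD at packing fraction 0.05–0.2, N = 10⁴–10⁶, smooth shear +
compression local-Gibbs data: (i) the pair statistic of
RelativeCoherence must fall like C r² + O(N^(−1/3) t) — any N-independent floor kills the line; (ii)
insert massless specular walls on an
Euler-transported grid (δ = 1/4, 1/8) and compare cell-averaged density / momentum / energy
histories with the free run: differences must
shrink like Kn_cell; (iii) lookup already done: Wright2007 Thm 1 is for finitely many
NON-interacting particles and ONE piston — no interacting,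
many-cell or n → ∞ averaging theorem is in print, so PistonCellAdiabat is not `known`.

NUMBERS. Fixed reduced density: (N+1)ε³ = σ³; mean free path λ ≍ N^(−1/3)/σ² (macroscopic units);
collisions per particle per unit time ≍ N^(1/3);
self-diffusion length over time t: (λ v_th t)^(1/2) ≍ N^(−1/6); first Chapman–Enskog approximations
for rigid spheres: D₁₁ = (3/8nσ²)(kT/πm)^(1/2)
(ChapmanCowling1970 §14.5, PDF p260), ρD₁₁/μ = 1.204 (PDF p246), λ_heat = f μ c_v with f = 2.522
(PDF p244) ⇒ thermal diffusivity / self-diffusion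
= 2.09 (isochoric) or 1.26 (isobaric): Lewis number O(1), so "cell thermalises in time 1" ⇔ "cell
leaks in time 1" — the reason the adiabatic
law is run with local, not global, relaxation. Wall layer volume fraction ≍ ε/δ = σN^(−1/3)/δ;
transparency heuristic error Kn_cell = λ/δ.
Items at open: 5 typed (target, 2 cruxes, 1 support, assembly) + 2 informal cruxes filed after open
= 7.

DEFINITION REQUESTS. MovingWallHardSphereFlow (topic Literature/Analysis/FluidPDE): N hard spheres
of diameter ε in a time-dependent domain Ω(t) ⊂ 𝕋³ (or a
polyhedral/affinely deformed cell) with elastic sphere–sphere collisions and specular reflection off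
∂Ω(t) moving with prescribed normal
velocity; good set, flow map, Liouville preservation on the moving phase space, trajectory structure
— as a hypothesis structure mirroring
Kinetic.HardSphereFlow; plus the fixed-box special case (needed also by cards
lagrangian-coherence-retardation CN3, gas-is-its-own-heat-bath,
flat-faces-polyhedra). Filed with `ledger workitem add --kind definition` against WallTransparency
after open. Cite facts wanted later:
Wright2007 Thm 1 (Anosov averaging for a piston + ideal gas in ergodic containers), Kasuga1961
(ergodic adiabatic theorem).

Novelty: Searches (2026-08-15): `lit search --source crossref "Wright periodic oscillation adiabatic piston
two or three dimensions"` (hit 1 =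
doi:10.1007/s00220-007-0317-0; read arXiv:math/0612401 pp. 1–7: Thm 1, ideal non-interacting
particles, one piston, ergodicity assumed);
`lit cite` sweeps for NeishtadtSinai2004, Kasuga1961, LochakMeunier1988, ChernovLebowitzSinai2002,
Simanyi1999 (all added to references.bib);
`lit read book:chapman1970 --grep self-diffusion` (PDF p244, p246, p260); `lit read book:spohn1991
--grep` (PDF p11, p41–42, p149–151);
`lit galaxy search "adiabatic piston" --star all` and `"slowly moving walls"` (galaxyd saturated, 0
usable hits; local searchd down, OpenAlex
429 — refuter to re-run "averaging theorem hydrodynamic limit hard spheres", "momentum field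
suffices Euler limit"); the nine route files and
the cards anosov-kasuga-pistons, ergodic-adiabatic-otto-reduction, bernoulli-piston-chain,
lagrangian-coherence-retardation,
closed-cells-mix-hydrodynamically-slowly, gas-is-its-own-heat-bath. Nearest prior art found:
Wright2007 (doi:10.1007/s00220-007-0317-0) and
NeishtadtSinai2004 (one heavy piston, ideal gas, Anosov averaging); Kasuga1961 / LochakMeunier1988
(ergodic adiabatic theorem, fixed
dimension); Spohn1991 §8.9 (self-diffusion as a diffusive-scale phenomenon); on the ledger,
lagrangian-coherence-retardation (coherence
relative to the Euler map, fading memory) and ChaoticMixing (uniform mixing + entropy). Delta: the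
conjunct is reduced, by a certifie  [refs: 10.1007/s00220-007-0317-0, math/0612401, doi:10.1007/s00220-007-0317-0, book:chapman1970, book:spohn1991, NeishtadtSinai2004, Kasuga1961, LochakMeunier1988, ChernovLebowitzSinai2002, Simanyi1999, Wright2007, Spohn1991]

Barriers (technique_class: averaging-theorem, adiabatic-invariant, lagrangian-cells): - technique_class: averaging-theorem, adiabatic-invariant, lagrangian-cells
- Literature.Barriers.AtomisticToContinuum.BoltzmannHypothesisBarrier: not in its technique class
(no entropy method, no classification of stationary states of the infinite system); its ideal-gas
kernel is respected twice: RelativeCoherence is FALSE for free flight (ballistic neighbours separate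
at O(1)) and the piston cell with an ideal gas is non-ergodic (each |v·n| conserved between parallel
walls) — the line uses collisions exactly where the barrier says it must; the honest residue is the
uniform LOCAL relaxation input inside AdiabaticClosure / PistonCellAdiabat, stated, not evaded.
- Literature.Barriers.AtomisticToContinuum.MacroErgodicityBarrier: same remark; no
one-block/two-block estimate, no macro-ergodicity of an infinite system; cells are finite and closed
by walls (piston gas) or by coherence (free gas).
- Literature.Barriers.AtomisticToContinuum.HighMomentumCutoffBarrier: not met by the typed layer
(all statements are convergence in probability; kinetic energy per particle is tight by
conservation); it returns inside any FLUX-level proof of AdiabaticClosure through the energy current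
(cubic moments) — conceded, shared with every route (KineticWindows' EnergyCurrentTails).
- Literature.Barriers.AtomisticToContinuum.VelocityReversalBarrier: not met — random local Gibbs
data, convergence in probability, pre-shock; the piston gas and the averaged (adiabatic) dynamics
are themselves reversible

History (route lifecycle, newest last):
- 2026-08-15T13:38:26Z · CLOSED retired — not-a-thesis: assembly does not conclude the sub-problem Statement (operator:999:1257524)

sub-problem: HydrodynamicLimit · status: closed(retired) · opened planner-plancard-AtomisticToContinuum-Hydrody-f7c64776-0 2026-08-15T11:40:54Z · rev 0 · ledger route-AtomisticToContinuum-AdiabaticPistons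
GENERATED by the gate from the ledger (D-0016/17). Provers cite these decls: `theorem foo : Summit.AtomisticToContinuum.HydrodynamicLimit.Theses.AdiabaticPistons.<Decl> := …` in Summits/AtomisticToContinuum/HydrodynamicLimit/Theorems/<Name>.lean.
-/

namespace Summit.AtomisticToContinuum.HydrodynamicLimit.Theses.AdiabaticPistons

open scoped BigOperators Topology Manifold Classical MeasureTheory ProbabilityTheory Matrix InnerProductSpace ComplexConjugate ContinuousMap
open Filter Set Function TopologicalSpace MeasureTheory

attribute [summit_statement] _root_.HydrodynamicLimit

/-- item stmt-AtomisticToContinuum-5365 · target · rank 0 · closed · moot by None · by planner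
why it might fail: it is the kinematic two-thirds of the conjunct: needs the momentum-flux closure Π → ρu⊗u + p𝟙 along the deterministic flow at fixed density; no dynamical mixing theorem exists (Spohn1991 PDF p11); the piston device moves the burden to WallTransparency.
sources: Spohn1991, OllaVaradhanYau1993, Wright2007, NeishtadtSinai2004
[target] for all continuous local-equilibrium profiles ∃ σ₀ ∀ σ<σ₀ ∀ classical hs-Euler solutions on
[0,T) ∀ hard-sphere flows: the local Gibbs laws are probability measures and, if the three fields
converge at t = 0, then at every t < T the empirical MOMENTUM field tested against every continuous
χ converges in probability to ∫χρ_t u_t. -/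
@[route_item "route-AtomisticToContinuum-AdiabaticPistons"]
def MomentumLimit : Prop :=
  ∀ (a₀ θ₀ : Literature.MathematicalPhysics.KineticTheory.T3 → ℝ) (u₀ : Literature.MathematicalPhysics.KineticTheory.T3 → Literature.MathematicalPhysics.KineticTheory.V3), Continuous a₀ → Continuous θ₀ → Continuous u₀ → (∀ x, 0 < a₀ x) → (∀ x, 0 < θ₀ x) → ∃ σ₀ : ℝ, 0 < σ₀ ∧ ∀ σ : ℝ, 0 < σ → σ < σ₀ → ∀ (T : ℝ) (ρ θ : ℝ → Literature.MathematicalPhysics.KineticTheory.T3 → ℝ) (u : ℝ → Literature.MathematicalPhysics.KineticTheory.T3 → Literature.MathematicalPhysics.KineticTheory.V3), Literature.MathematicalPhysics.KineticTheory.IsHardSphereEulerSolution σ T ρ u θ → ∀ Φ : (N : ℕ) → Literature.Analysis.FluidPDE.HardSphereFlow (Literature.Analysis.FluidPDE.Torus.geometry (Fin 3)) (Literature.MathematicalPhysics.KineticTheory.hsDiameter σ N) (N + 1), (∀ N, MeasureTheory.IsProbabilityMeasure (Literature.MathematicalPhysics.KineticTheory.localGibbsLaw σ a₀ u₀ θ₀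 N (Φ N))) ∧ (Literature.MathematicalPhysics.KineticTheory.TendstoHydroFieldsAt (fun N => Literature.MathematicalPhysics.KineticTheory.localGibbsLaw σ a₀ u₀ θ₀ N (Φ N)) Φ ρ u θ 0 → ∀ t ∈ Set.Ico 0 T, ∀ χ : Literature.MathematicalPhysics.KineticTheory.T3 → ℝ, Continuous χ → ∀ δ : ℝ, 0 < δ → Filter.Tendsto (fun N => Literature.MathematicalPhysics.KineticTheory.localGibbsLaw σ a₀ u₀ θ₀ N (Φ N) {z | δ < ‖Literature.MathematicalPhysics.KineticTheory.empiricalMomentumField ((Φ N).flow t z) χ - ∫ x, (χ x * ρ t x) • u t x‖}) Filter.atTop (nhds 0))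

-- item stmt-AtomisticToContinuum-6331 · crux · rank 2 · closed · moot by None · by planner — informal only, no Lean statement yet:
--   [crux] WALL TRANSPARENCY (card anosov-kasuga-pistons crux 3; the obstruction, honestly ranked 2):
--   for σ < σ₀, continuous local Gibbs profiles, a classical hs-Euler solution (ρ,u,θ) on [0,T) and t <
--   T, compare (A) the free hard-sphere gas (N+1 spheres of diameter σ(N+1)^{-1/3} on 𝕋³,
--   Kinetic.HardSphereFlow) with (B) the PISTON GAS: the same spheres plus massless specular walls on
--   the faces of a cubic δ-grid transported by the flow map X_t of u (reflection v ↦ v − 2((v −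
--   u(t,x))·n)n at a wall point x with unit normal n), same local Gibbs initial law. CLAIM: for every
--   continuous χ and η > 0, lim_

/-- item stmt-AtomisticToContinuum-5366 · crux · rank 3 · closed · moot by None · by planner
why it might fail: needs decay of a tagged sphere's peculiar-velocity autocorrelation over kinetic times in a NON-equilibrium gas at fixed density (displacement ≍ N^(−1/6)); rigorous self-diffusion exists only in equilibrium at Boltzmann–Grad (BGSR 2016); a persistent ballistic sub-population would break it.
sources: Spohn1991, BodineauGallagherSaintRaymondInvent2016, AlderWainwright1970, ChapmanCowling1970
[crux] RELATIVE LAGRANGIAN COHERENCE (closed parcels; card § Mechanism "self-diffusion is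
sub-macroscopic"): for profiles, σ < σ₀, a classical hs-Euler solution on [0,T), flows with
probability local Gibbs laws whose fields converge at 0, there is C such that for every t < T, r >
0, η > 0 the probability that the pair-weighted mean square difference of LIFTED displacements ∫₀ᵗ
v_i − ∫₀ᵗ v_j over pairs initially within torus distance r (tent weight, diagonal included) exceeds
C r² + η tends to 0 as N → ∞. False for the ideal gas and at Boltzmann–Grad (ballistic flights); the
statement uses collisions. [difficulty: XL] -/
@[route_item "route-AtomisticToContinuum-AdiabaticPistons"]
def RelativeCoherence : Prop :=
  ∀ (a₀ θ₀ : Literature.MathematicalPhysics.KineticTheory.T3 → ℝ) (u₀ : Literature.MathematicalPhysics.KineticTheory.T3 → Literature.MathematicalPhysics.KineticTheory.V3), Continuous a₀ → Continuous θ₀ → Continuous u₀ → (∀ x, 0 < a₀ x) → (∀ x, 0 < θ₀ x) → ∃ σ₀ : ℝ, 0 < σ₀ ∧ ∀ σ : ℝ, 0 < σ → σ < σ₀ → ∀ (T : ℝ) (ρ θ : ℝ → Literature.MathematicalPhysics.KineticTheory.T3 → ℝ) (u : ℝ → Literature.MathematicalPhysics.KineticTheory.T3 → Literature.MathematicalPhysics.KineticTheory.V3),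 Literature.MathematicalPhysics.KineticTheory.IsHardSphereEulerSolution σ T ρ u θ → ∀ Φ : (N : ℕ) → Literature.Analysis.FluidPDE.HardSphereFlow (Literature.Analysis.FluidPDE.Torus.geometry (Fin 3)) (Literature.MathematicalPhysics.KineticTheory.hsDiameter σ N) (N + 1), (∀ N, MeasureTheory.IsProbabilityMeasure (Literature.MathematicalPhysics.KineticTheory.localGibbsLaw σ a₀ u₀ θ₀ N (Φ N))) → Literature.MathematicalPhysics.KineticTheory.TendstoHydroFieldsAt (fun N => Literature.MathematicalPhysics.KineticTheory.localGibbsLaw σ a₀ u₀ θ₀ N (Φ N)) Φ ρ u θ 0 → ∃ C : ℝ, ∀ t ∈ Set.Ico 0 T, ∀ r : ℝ, 0 < r → ∀ η : ℝ, 0 < η → Filter.Tendsto (fun N => Literature.MathematicalPhysics.KineticTheory.localGibbsLaw σ a₀ u₀ θ₀ N (Φ N) {z | C * r ^ 2 + η < (∑ i : Fin (N + 1), ∑ j : Fin (N + 1), max 0 (1 - Literature.Analysis.FluidPDE.Torus.euclidDist (z i).1 (z j).1 / r) * ‖(∫ s in (0 : ℝ)..t, ((Φ N).flow s z i).2) -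 ∫ s in (0 : ℝ)..t, ((Φ N).flow s z j).2‖ ^ 2) / (∑ i : Fin (N + 1), ∑ j : Fin (N + 1), max 0 (1 - Literature.Analysis.FluidPDE.Torus.euclidDist (z i).1 (z j).1 / r))}) Filter.atTop (nhds 0)

/-- item stmt-AtomisticToContinuum-5367 · crux · rank 4 · closed · moot by None · by planner
why it might fail: kinematic fields do not control the deviatoric stress or the heat current: a divergence-free anomalous stress S with S:∇u ≠ 0, or an O(1) heat flux, would move internal energy between parcels at Euler order while ρ, ρu stay exact; needs local isotropy + contact statistics.
sources: Spohn1991, Kasuga1961, LochakMeunier1988, Wright2007, ChapmanCowling1970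
[crux] ADIABATIC CLOSURE (Lagrangian cells are adiabatic pistons; card cruxes 1–2 corrected): for
profiles ∃ σ₀ ∀ σ<σ₀ ∀ classical hs-Euler solutions on [0,T) ∀ flows with probability local Gibbs
laws and fields converging at 0: IF the density and momentum fields converge at every s ∈ [0,T) THEN
the energy field converges at every t ∈ [0,T) to ∫χE_t, E = ρ(|u|²/2 + 3θ/2) — the temperature
follows the hard-sphere adiabat transported by the flow. Mechanism: closed parcels
(RelativeCoherence) + local velocity isotropy ⇒ time-averaged stress π𝟙 with π_kin = 2e_int/3
identically; kinematics fix ∇π = ∇p; global energy conservation fixes the constant; contact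
statistics give the excess part ρθ(Z−1). [deps: RelativeCoherence] [difficulty: XL] -/
@[route_item "route-AtomisticToContinuum-AdiabaticPistons"]
def AdiabaticClosure : Prop :=
  ∀ (a₀ θ₀ : Literature.MathematicalPhysics.KineticTheory.T3 → ℝ) (u₀ : Literature.MathematicalPhysics.KineticTheory.T3 → Literature.MathematicalPhysics.KineticTheory.V3), Continuous a₀ → Continuous θ₀ → Continuous u₀ → (∀ x, 0 < a₀ x) → (∀ x, 0 < θ₀ x) → ∃ σ₀ : ℝ, 0 < σ₀ ∧ ∀ σ : ℝ, 0 < σ → σ < σ₀ → ∀ (T : ℝ) (ρ θ : ℝ → Literature.MathematicalPhysics.KineticTheory.T3 → ℝ) (u : ℝ → Literature.MathematicalPhysics.KineticTheory.T3 → Literature.MathematicalPhysics.KineticTheory.V3), Literature.MathematicalPhysics.KineticTheory.IsHardSphereEulerSolution σ T ρ u θ → ∀ Φ : (N : ℕ) → Literature.Analysis.FluidPDE.HardSphereFlow (Literature.Analysis.FluidPDE.Torus.geometry (Fin 3)) (Literature.MathematicalPhysics.KineticTheory.hsDiameter σ N) (N + 1), (∀ N, MeasureTheory.IsProbabilityMeasure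 (Literature.MathematicalPhysics.KineticTheory.localGibbsLaw σ a₀ u₀ θ₀ N (Φ N))) → Literature.MathematicalPhysics.KineticTheory.TendstoHydroFieldsAt (fun N => Literature.MathematicalPhysics.KineticTheory.localGibbsLaw σ a₀ u₀ θ₀ N (Φ N)) Φ ρ u θ 0 → (∀ s ∈ Set.Ico 0 T, (∀ χ : Literature.MathematicalPhysics.KineticTheory.T3 → ℝ, Continuous χ → ∀ δ : ℝ, 0 < δ → Filter.Tendsto (fun N => Literature.MathematicalPhysics.KineticTheory.localGibbsLaw σ a₀ u₀ θ₀ N (Φ N) {z | δ < |Literature.MathematicalPhysics.KineticTheory.empiricalDensityField ((Φ N).flow s z) χ - ∫ x, χ x * ρ s x|}) Filter.atTop (nhds 0)) ∧ (∀ χ : Literature.MathematicalPhysics.KineticTheory.T3 → ℝ, Continuous χ → ∀ δ : ℝ, 0 < δ → Filter.Tendsto (fun N => Literature.MathematicalPhysics.KineticTheory.localGibbsLaw σ a₀ u₀ θ₀ N (Φ N) {z | δ < ‖Literature.MathematicalPhysics.KineticTheory.empiricalMomentumField ((Φ N).flow s z) χ - ∫ x, (χ x * ρ s x) • u s x‖})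 Filter.atTop (nhds 0))) → ∀ t ∈ Set.Ico 0 T, ∀ χ : Literature.MathematicalPhysics.KineticTheory.T3 → ℝ, Continuous χ → ∀ δ : ℝ, 0 < δ → Filter.Tendsto (fun N => Literature.MathematicalPhysics.KineticTheory.localGibbsLaw σ a₀ u₀ θ₀ N (Φ N) {z | δ < |Literature.MathematicalPhysics.KineticTheory.empiricalEnergyField ((Φ N).flow t z) χ - ∫ x, χ x * Literature.MathematicalPhysics.KineticTheory.totalEnergyDensity (ρ t x) (u t x) (θ t x)|}) Filter.atTop (nhds 0)

-- item stmt-AtomisticToContinuum-6349 · crux · rank 5 · closed · moot by None · by planner — informal only, no Lean statement yet: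
--   [crux] PISTON CELL ADIABAT (card cruxes 1–2, CORRECTED by this route's Lewis-number audit: local,
--   not global, relaxation): ONE closed cell suffices, because with prescribed Euler-transported walls
--   the cells of the piston gas are independent closed systems. SETTING: n = ρδ³(N+1) hard spheres of
--   diameter σ(N+1)^{-1/3} in the moving cell X_t(Q), Q a cube of side δ, walls specular and moving with
--   u (MovingWallHardSphereFlow), initial law = local Gibbs restricted to the cell. CLAIM: as N → ∞ at
--   FIXED δ (and then uniformly in δ ≤ δ₀), in probability: (i) the cell's empirical density and
--   momentum fie

/-- item stmt-AtomisticToContinuum-5368 · support · rank 9 · closed · moot by None · by planner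
sources: Spohn1991
[support] THE CONTINUITY EQUATION IS FREE: for every σ > 0, hs-Euler solution on [0,T), flows,
probability local Gibbs laws with fields converging at 0: if the momentum field converges at every s
∈ [0,T) then the density field converges at every t ∈ [0,T). Proof: positions are continuous and
piecewise free flights (IsHardSphereTrajectory.eq_freeFlight), so ⟨ρ_N(t),χ⟩ − ⟨ρ_N(0),χ⟩ = ∫₀ᵗ Σ_k
(empiricalMomentumField (∂_kχ))_k ds exactly for C¹ χ; momentum convergence at each s + tightness of
kinetic energy per particle (energy field at 0, conservation) + dominated convergence ⇒ limit
∫₀ᵗ∫ρu·∇χ = ∫χρ_t − ∫χρ_0 by the Euler mass equation; approximate continuous χ uniformly. Chore: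
joint measurability of (s,z) ↦ flow s z on the good set (piecewise continuity). [difficulty: M] -/
@[route_item "route-AtomisticToContinuum-AdiabaticPistons"]
def DensityFromMomentum : Prop :=
  ∀ (σ : ℝ) (a₀ θ₀ : Literature.MathematicalPhysics.KineticTheory.T3 → ℝ) (u₀ : Literature.MathematicalPhysics.KineticTheory.T3 → Literature.MathematicalPhysics.KineticTheory.V3), 0 < σ → ∀ (T : ℝ) (ρ θ : ℝ → Literature.MathematicalPhysics.KineticTheory.T3 → ℝ) (u : ℝ → Literature.MathematicalPhysics.KineticTheory.T3 → Literature.MathematicalPhysics.KineticTheory.V3), Literature.MathematicalPhysics.KineticTheory.IsHardSphereEulerSolution σ T ρ u θ → ∀ Φ : (N : ℕ) → Literature.Analysis.FluidPDE.HardSphereFlow (Literature.Analysis.FluidPDE.Torus.geometry (Fin 3)) (Literature.MathematicalPhysics.KineticTheory.hsDiameter σ N) (N + 1), (∀ N, MeasureTheory.IsProbabilityMeasure (Literature.MathematicalPhysics.KineticTheory.localGibbsLaw σ a₀ u₀ θ₀ N (Φ N))) → Literature.MathematicalPhysics.KineticTheory.TendstoHydroFieldsAt (fun N => Literature.MathematicalPhysics.KineticTheory.localGibbsLaw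 σ a₀ u₀ θ₀ N (Φ N)) Φ ρ u θ 0 → (∀ s ∈ Set.Ico 0 T, ∀ χ : Literature.MathematicalPhysics.KineticTheory.T3 → ℝ, Continuous χ → ∀ δ : ℝ, 0 < δ → Filter.Tendsto (fun N => Literature.MathematicalPhysics.KineticTheory.localGibbsLaw σ a₀ u₀ θ₀ N (Φ N) {z | δ < ‖Literature.MathematicalPhysics.KineticTheory.empiricalMomentumField ((Φ N).flow s z) χ - ∫ x, (χ x * ρ s x) • u s x‖}) Filter.atTop (nhds 0)) → ∀ t ∈ Set.Ico 0 T, ∀ χ : Literature.MathematicalPhysics.KineticTheory.T3 → ℝ, Continuous χ → ∀ δ : ℝ, 0 < δ → Filter.Tendsto (fun N => Literature.MathematicalPhysics.KineticTheory.localGibbsLaw σ a₀ u₀ θ₀ N (Φ N) {z | δ < |Literature.MathematicalPhysics.KineticTheory.empiricalDensityField ((Φ N).flow t z) χ - ∫ x, χ x * ρ t x|}) Filter.atTop (nhds 0)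

/-- item stmt-AtomisticToContinuum-5369 · assembly · rank 1 · closed · moot by None · by planner
sources: Spohn1991, OllaVaradhanYau1993
[assembly] AdiabaticClosure → DensityFromMomentum → MomentumLimit → HydrodynamicLimit. -/
@[route_item "route-AtomisticToContinuum-AdiabaticPistons"]
def Assembly : Prop :=
  AdiabaticClosure → DensityFromMomentum → MomentumLimit → Literature.MathematicalPhysics.KineticTheory.HydrodynamicLimit

end Summit.AtomisticToContinuum.HydrodynamicLimit.Theses.AdiabaticPistons
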